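import Mathlib
import HarnessLib
import Summits.Ventures.LatticeQCDFlow.Scaling.AutoregressiveGaugeHeatBathKL
import Summits.Ventures.LatticeQCDFlow.Scaling.TorusRankedMorseCount

/-!
# LatticeQCDFlow / Scaling — the OPTIMAL exact one-plaquette heat-bath autoregression of `(ℤ/L)^d`:
# the Morse sampler is exact and implementable, its Metropolis step certifies acceptance
# `≥ (m/M)^{k_min}`, `τ_int ≤ (M/m)^{k_min} − 1/2`, training loss `≤ k_min·log(M/m)` with
# `k_min = (d−1)(d−2)/2·L^d + (d−1)` — and no ranked structure certifies a better floor

HONEST FRAMING: exact (Metropolis-corrected) sampling algorithms for lattice gauge theory;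
figures of merit are autocorrelation/cost numbers at stated couplings and volumes; no
continuum-physics claim.

Venture `LatticeQCDFlow` (cell pub-lqcd), topic `Scaling`, FANOUT row 30 (lean-1, GEN-25) — OUR WORK on
THEORY-2.md §4 row C5, the scorecard of the generation.  `w` continuous with `0 < m ≤ w ≤ M` on a compact
group `G`, `L ≥ 2`, any `d`; `B`, `t` = the Morse structure of `TorusRankedMorseStructure` (hypotheses
`hB`, `ht` fix them to the explicit terms), `k_min := (d−1)(d−2)/2·L^d + (d−1)`.

* §1 THE SAMPLER: **`integral_prod_weight_morse_eq_pow`** (`Z_B = c^{(d−1)(L^d−1)}`, `c = ∫ w dHaar`);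
  **`morse_arHybrid_eq_target`** — for every duplicate-free list `l` of all links the heat-bath hybrid of
  the Morse conditioners `q_b = ∏_{p ∈ B, t p = b} w(U_p)/c` reproduces `F_B/Z_B` EXACTLY (ancestral
  sampling draws from `(F_B/Z_B)·Haar^{⊗E}`); **`exists_morse_compatible_order`** — a generation order of
  all links along which every conditioner reads only links already drawn;
* §2 THE METROPOLIS STEP against the full weight `∏_{all p} w(U_p)`: **`morse_imhAcceptQ_ge`** —
  acceptance `≥ (m/M)^{k_min}` from EVERY state for EVERY proposal; **`morse_autocorrelation`** —
  `|C_f(t)| ≤ (1 − (m/M)^{k_min})^t ∫f² dπ` and `τ_int(f) ≤ (M/m)^{k_min} − 1/2` for every bounded measurable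
  centred `f`; **`morse_kl_le`** — training loss `KL(π ‖ q_B) ≤ k_min·log(M/m)`;
* §3 OPTIMALITY OF THE CERTIFICATE: **`ranked_doeblin_floor_le_pow_kmin`** — for EVERY ranked structure
  the certified floor `(m/M)^{#Bᶜ}` is `≤ (m/M)^{k_min}` (`TorusRankedHomologyBound`), so the Morse
  structure is optimal for this route in every dimension; instances **`morse_imhAcceptQ_ge_three`**
  (`(m/M)^{L³+2}`, the layers gave `(m/M)^{L³+2L²}`) and **`morse_imhAcceptQ_ge_four`** (`(m/M)^{3L⁴+3}`).
NOT CLAIMED: that `τ_int` of these samplers actually grows with the volume in `d ≥ 3` (the uncovered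
plaquettes are constrained by the covered ones through the cube identities; a lower bound needs their
law under the proposal); anything about conditioners beyond one-plaquette heat baths.

No `def`, no `sorry`, nothing cited as a fact beyond the tree.
-/

noncomputable section

namespace Summit.Ventures.LatticeQCDFlow.Theory2.Autoregressive

open MeasureTheory ProbabilityTheory Function Finset
open Literature.MathematicalPhysics.QuantumFieldTheory Literature.MathematicalPhysics.QuantumLattice
open Summit.Ventures.LatticeQCDFlow.Exactness Summit.Ventures.LatticeQCDFlow.Scoring

variable {d L : ℕ} [NeZero L] {G : Type*} [Group G] [TopologicalSpace G] [IsTopologicalGroup G]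
  [CompactSpace G] [SecondCountableTopology G] [MeasurableSpace G] [BorelSpace G]

/-! ## §1 The Morse sampler: normalisation, exactness, a compatible order -/

/-- **`Z_B = c^{(d−1)(L^d − 1)}`** for the Morse structure (`L ≥ 2`, `c = ∫ w dHaar`). [ours] -/
theorem integral_prod_weight_morse_eq_pow (hL : 2 ≤ L) {w : G → ℝ} (hw : Continuous w) {m M : ℝ}
    (hm0 : 0 < m) (hm : ∀ g, m ≤ w g) (hM : ∀ g, w g ≤ M) (B : Finset (Plaquette d L))
    (t : Plaquette d L → Edge d L)
    (hB : B = Finset.univ.filter (fun p : Plaquette d L =>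
      (∀ m : Fin d, m < p.2.1.1 → p.1 m = 0) ∧
        (p.1 p.2.1.1 ≠ -1 ∨ ((∀ m : Fin d, p.2.1.1 < m → m < p.2.1.2 → p.1 m = 0) ∧ p.1 p.2.1.2 ≠ -1))))
    (ht : t = fun p => if p.1 p.2.1.1 = -1 then (p.1.shift p.2.1.2, p.2.1.1) else (p.1.shift p.2.1.1, p.2.1.2)) :
    ∫ U, ∏ p ∈ B, w (plaquetteHolonomy U p.1 p.2.1.1 p.2.1.2) ∂(Measure.pi fun _ : Edge d L => haarProbability G) =
      (∫ g, w g ∂(haarProbability G)) ^ ((d - 1) * (L ^ d - 1)) := by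
  rw [integral_prod_weight_eq_pow_of_rank hL hw hm0 hm hM B t (fun p _ => morse_mem_links t ht p) _
    (morse_rank_lt hL B t _ hB ht rfl), card_morse hL B hB]

/-- **THE MORSE SAMPLER IS EXACT** (every `d`, `L ≥ 2`): with the conditioners
`q_b(U) = ∏_{p ∈ B, t p = b} w(U_p)/c`, for every duplicate-free list `l` of ALL links
`(∏_{b∈l} q_b(U))·A_l F_B(U)/Z_B = F_B(U)/Z_B` — the law of the ancestral sampler along `l` is
`(F_B/Z_B)·Haar^{⊗E}` (`Scaling/AutoregressiveGaugeHeatBathRanked`). [ours] -/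
theorem morse_arHybrid_eq_target (hL : 2 ≤ L) {w : G → ℝ} (hw : Continuous w) {m M : ℝ}
    (hm0 : 0 < m) (hm : ∀ g, m ≤ w g) (hM : ∀ g, w g ≤ M) (B : Finset (Plaquette d L))
    (t : Plaquette d L → Edge d L)
    (hB : B = Finset.univ.filter (fun p : Plaquette d L =>
      (∀ m : Fin d, m < p.2.1.1 → p.1 m = 0) ∧
        (p.1 p.2.1.1 ≠ -1 ∨ ((∀ m : Fin d, p.2.1.1 < m → m < p.2.1.2 → p.1 m = 0) ∧ p.1 p.2.1.2 ≠ -1))))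
    (ht : t = fun p => if p.1 p.2.1.1 = -1 then (p.1.shift p.2.1.2, p.2.1.1) else (p.1.shift p.2.1.1, p.2.1.2))
    (l : List (Edge d L)) (hl : l.Nodup) (hall : ∀ e : Edge d L, e ∈ l) (U : GaugeConfig d L G) :
    (l.map fun b => ∏ p ∈ B.filter (fun p' => t p' = b),
        w (plaquetteHolonomy U p.1 p.2.1.1 p.2.1.2) / (∫ g, w g ∂(haarProbability G))).prod *
        coordAvg (haarProbability G) l.toFinset
          (fun V : GaugeConfig d L G => ∏ p ∈ B, w (plaquetteHolonomy V p.1 p.2.1.1 p.2.1.2)) U /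
        (∫ V, ∏ p ∈ B, w (plaquetteHolonomy V p.1 p.2.1.1 p.2.1.2)
          ∂(Measure.pi fun _ : Edge d L => haarProbability G)) =
      (∏ p ∈ B, w (plaquetteHolonomy U p.1 p.2.1.1 p.2.1.2)) /
        (∫ V, ∏ p ∈ B, w (plaquetteHolonomy V p.1 p.2.1.1 p.2.1.2)
          ∂(Measure.pi fun _ : Edge d L => haarProbability G)) :=
  ranked_arHybrid_eq_target hL hw hm0 hm hM B t (fun p _ => morse_mem_links t ht p) _
    (morse_rank_lt hL B t _ hB ht rfl) l hl hall U

/-- **A compatible generation order for the Morse structure**: a duplicate-free list of all links along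
which, for every `p ∈ B`, the three links of `p` other than `t p` come before `t p` — so the conditioner at
`t p` reads only links already drawn. [ours] -/
theorem exists_morse_compatible_order (hL : 2 ≤ L) (B : Finset (Plaquette d L))
    (t : Plaquette d L → Edge d L)
    (hB : B = Finset.univ.filter (fun p : Plaquette d L =>
      (∀ m : Fin d, m < p.2.1.1 → p.1 m = 0) ∧
        (p.1 p.2.1.1 ≠ -1 ∨ ((∀ m : Fin d, p.2.1.1 < m → m < p.2.1.2 → p.1 m = 0) ∧ p.1 p.2.1.2 ≠ -1))))
    (ht : t = fun p => if p.1 p.2.1.1 = -1 then (p.1.shift p.2.1.2, p.2.1.1) else (p.1.shift p.2.1.1, p.2.1.2)) :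
    ∃ l : List (Edge d L), l.Nodup ∧ (∀ e : Edge d L, e ∈ l) ∧
      ∀ p ∈ B, ∀ e' ∈ ({(p.1, p.2.1.1), (p.1.shift p.2.1.1, p.2.1.2),
          (p.1.shift p.2.1.2, p.2.1.1), (p.1, p.2.1.2)} : Finset (Edge d L)),
        e' ≠ t p → l.idxOf e' < l.idxOf (t p) :=
  exists_order_of_topLink_rank B t (morse_injOn hL B t hB ht) _ (morse_rank_lt hL B t _ hB ht rfl)

/-! ## §2 The Metropolis step: acceptance, autocorrelation, training loss -/

/-- **THE MORSE SAMPLER AS A PROPOSAL: acceptance `≥ (m/M)^{k_min}`**, `k_min = (d−1)(d−2)/2·L^d + (d−1)`,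
from EVERY state for EVERY proposal, against the full weight `∏_{all p} w(U_p)` (`L ≥ 2`, every `d`,
every duplicate-free list of all links). [ours] -/
theorem morse_imhAcceptQ_ge (hL : 2 ≤ L) {w : G → ℝ} (hw : Continuous w) {m M : ℝ} (hm0 : 0 < m)
    (hm : ∀ g, m ≤ w g) (hM : ∀ g, w g ≤ M) (B : Finset (Plaquette d L)) (t : Plaquette d L → Edge d L)
    (hB : B = Finset.univ.filter (fun p : Plaquette d L =>
      (∀ m : Fin d, m < p.2.1.1 → p.1 m = 0) ∧
        (p.1 p.2.1.1 ≠ -1 ∨ ((∀ m : Fin d, p.2.1.1 < m → m < p.2.1.2 → p.1 m = 0) ∧ p.1 p.2.1.2 ≠ -1))))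
    (ht : t = fun p => if p.1 p.2.1.1 = -1 then (p.1.shift p.2.1.2, p.2.1.1) else (p.1.shift p.2.1.1, p.2.1.2))
    (l : List (Edge d L)) (hl : l.Nodup) (hall : ∀ e : Edge d L, e ∈ l) (U V : GaugeConfig d L G) :
    (m / M) ^ ((d - 1) * (d - 2) / 2 * L ^ d + (d - 1)) ≤
      imhAcceptQ (fun U : GaugeConfig d L G => ∏ p : Plaquette d L, w (plaquetteHolonomy U p.1 p.2.1.1 p.2.1.2))
        (fun U : GaugeConfig d L G => (l.map fun b => ∏ p ∈ B.filter (fun p' => t p' = b),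
            w (plaquetteHolonomy U p.1 p.2.1.1 p.2.1.2) / (∫ g, w g ∂(haarProbability G))).prod *
          coordAvg (haarProbability G) l.toFinset
            (fun V : GaugeConfig d L G => ∏ p ∈ B, w (plaquetteHolonomy V p.1 p.2.1.1 p.2.1.2)) U /
          (∫ V, ∏ p ∈ B, w (plaquetteHolonomy V p.1 p.2.1.1 p.2.1.2)
            ∂(Measure.pi fun _ : Edge d L => haarProbability G))) U V := by
  have h := ranked_imhAcceptQ_ge hL hw hm0 hm hM B t (fun p _ => morse_mem_links t ht p) _
    (morse_rank_lt hL B t _ hB ht rfl) l hl hall U V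
  rwa [card_compl_morse hL B hB] at h

/-- **THE MORSE PROPOSAL: `|C_f(t)| ≤ (1 − (m/M)^{k_min})^t ∫f² dπ` and `τ_int(f) ≤ (M/m)^{k_min} − 1/2`** for
the exact independence Metropolis chain with target `π = (F/Z)·Haar^{⊗E}` and proposal
`q = (F_B/Z_B)·Haar^{⊗E}` (the law of the Morse sampler), every bounded measurable centred `f`
(`Scaling/AutoregressiveGaugeHeatBathAnyDim`). [ours] -/
theorem morse_autocorrelation (hL : 2 ≤ L) {w : G → ℝ} (hw : Continuous w) {m M : ℝ} (hm0 : 0 < m)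
    (hm : ∀ g, m ≤ w g) (hM : ∀ g, w g ≤ M) (B : Finset (Plaquette d L))
    (hB : B = Finset.univ.filter (fun p : Plaquette d L =>
      (∀ m : Fin d, m < p.2.1.1 → p.1 m = 0) ∧
        (p.1 p.2.1.1 ≠ -1 ∨ ((∀ m : Fin d, p.2.1.1 < m → m < p.2.1.2 → p.1 m = 0) ∧ p.1 p.2.1.2 ≠ -1))))
    (π q : Measure (GaugeConfig d L G)) [IsProbabilityMeasure π] [IsProbabilityMeasure q]
    (hπ : π = (Measure.pi fun _ : Edge d L => haarProbability G).withDensity fun U =>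
      ENNReal.ofReal ((∏ p : Plaquette d L, w (plaquetteHolonomy U p.1 p.2.1.1 p.2.1.2)) /
        ∫ V, ∏ p : Plaquette d L, w (plaquetteHolonomy V p.1 p.2.1.1 p.2.1.2)
          ∂(Measure.pi fun _ : Edge d L => haarProbability G)))
    (hq : q = (Measure.pi fun _ : Edge d L => haarProbability G).withDensity fun U =>
      ENNReal.ofReal ((∏ p ∈ B, w (plaquetteHolonomy U p.1 p.2.1.1 p.2.1.2)) /
        ∫ V, ∏ p ∈ B, w (plaquetteHolonomy V p.1 p.2.1.1 p.2.1.2)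
          ∂(Measure.pi fun _ : Edge d L => haarProbability G)))
    {f : GaugeConfig d L G → ℝ} (hf : Measurable f) {C : ℝ} (hC : ∀ x, |f x| ≤ C)
    (hf0 : ∫ U, f U ∂π = 0) :
    (∀ s : ℕ, |autocov (indepMH q fun U =>
        ((∫ V, ∏ p : Plaquette d L, w (plaquetteHolonomy V p.1 p.2.1.1 p.2.1.2)
            ∂(Measure.pi fun _ : Edge d L => haarProbability G)) /
          ((∫ V, ∏ p ∈ B, w (plaquetteHolonomy V p.1 p.2.1.1 p.2.1.2)
            ∂(Measure.pi fun _ : Edge d L => haarProbability G)) *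
            ∏ p ∈ Finset.univ \ B, w (plaquetteHolonomy U p.1 p.2.1.1 p.2.1.2)))⁻¹) π f s|
        ≤ (1 - (m / M) ^ ((d - 1) * (d - 2) / 2 * L ^ d + (d - 1))) ^ s * ∫ x, f x ^ 2 ∂π) ∧
      tauInt (fun s => autocov (indepMH q fun U =>
        ((∫ V, ∏ p : Plaquette d L, w (plaquetteHolonomy V p.1 p.2.1.1 p.2.1.2)
            ∂(Measure.pi fun _ : Edge d L => haarProbability G)) /
          ((∫ V, ∏ p ∈ B, w (plaquetteHolonomy V p.1 p.2.1.1 p.2.1.2)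
            ∂(Measure.pi fun _ : Edge d L => haarProbability G)) *
            ∏ p ∈ Finset.univ \ B, w (plaquetteHolonomy U p.1 p.2.1.1 p.2.1.2)))⁻¹) π f s /
          autocov (indepMH q fun U =>
        ((∫ V, ∏ p : Plaquette d L, w (plaquetteHolonomy V p.1 p.2.1.1 p.2.1.2)
            ∂(Measure.pi fun _ : Edge d L => haarProbability G)) /
          ((∫ V, ∏ p ∈ B, w (plaquetteHolonomy V p.1 p.2.1.1 p.2.1.2)
            ∂(Measure.pi fun _ : Edge d L => haarProbability G)) *
            ∏ p ∈ Finset.univ \ B, w (plaquetteHolonomy U p.1 p.2.1.1 p.2.1.2)))⁻¹) π f 0) ≤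
        (M / m) ^ ((d - 1) * (d - 2) / 2 * L ^ d + (d - 1)) - 1 / 2 := by
  have h := plaquetteBlockProposal_autocorrelation hw hm0 hm hM B π q hπ hq hf hC hf0
  rwa [card_compl_morse hL B hB] at h

/-- **THE MORSE MODEL'S TRAINING LOSS: `KL(π ‖ q_B) ≤ k_min·log(M/m)`**, `k_min = (d−1)(d−2)/2·L^d + (d−1)`
(`Scaling/AutoregressiveGaugeHeatBathKL`; for the Wilson weight `log(M/m) = 2β`). [ours] -/
theorem morse_kl_le (hL : 2 ≤ L) {w : G → ℝ} (hw : Continuous w) {m M : ℝ} (hm0 : 0 < m)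
    (hm : ∀ g, m ≤ w g) (hM : ∀ g, w g ≤ M) (B : Finset (Plaquette d L))
    (hB : B = Finset.univ.filter (fun p : Plaquette d L =>
      (∀ m : Fin d, m < p.2.1.1 → p.1 m = 0) ∧
        (p.1 p.2.1.1 ≠ -1 ∨ ((∀ m : Fin d, p.2.1.1 < m → m < p.2.1.2 → p.1 m = 0) ∧ p.1 p.2.1.2 ≠ -1)))) :
    ∫ U, (∏ p : Plaquette d L, w (plaquetteHolonomy U p.1 p.2.1.1 p.2.1.2)) /
          (∫ V, ∏ p : Plaquette d L, w (plaquetteHolonomy V p.1 p.2.1.1 p.2.1.2)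
            ∂(Measure.pi fun _ : Edge d L => haarProbability G)) *
        Real.log (((∏ p : Plaquette d L, w (plaquetteHolonomy U p.1 p.2.1.1 p.2.1.2)) /
            ∫ V, ∏ p : Plaquette d L, w (plaquetteHolonomy V p.1 p.2.1.1 p.2.1.2)
              ∂(Measure.pi fun _ : Edge d L => haarProbability G)) /
          ((∏ p ∈ B, w (plaquetteHolonomy U p.1 p.2.1.1 p.2.1.2)) /
            ∫ V, ∏ p ∈ B, w (plaquetteHolonomy V p.1 p.2.1.1 p.2.1.2)
              ∂(Measure.pi fun _ : Edge d L => haarProbability G)))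
        ∂(Measure.pi fun _ : Edge d L => haarProbability G) ≤
      (((d - 1) * (d - 2) / 2 * L ^ d + (d - 1) : ℕ) : ℝ) * Real.log (M / m) := by
  have h := kl_blockLaw_le (G := G) hw hm0 hm hM B
  rwa [card_compl_morse hL B hB] at h

/-! ## §3 No ranked structure certifies a better floor; three and four dimensions -/

/-- **THE CERTIFIED FLOOR OF EVERY RANKED STRUCTURE IS AT MOST THE MORSE ONE**: for every ranked `B` of
`(ℤ/L)^d` (`L ≥ 2`, `0 < m ≤ M`), `(m/M)^{#Bᶜ} ≤ (m/M)^{k_min}` — the homology bound of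
`TorusRankedHomologyBound` in the currency of `ranked_imhAcceptQ_ge`. [ours] -/
theorem ranked_doeblin_floor_le_pow_kmin (hL : 2 ≤ L) {m M : ℝ} (hm0 : 0 < m) (hmM : m ≤ M)
    (B : Finset (Plaquette d L)) (t : Plaquette d L → Edge d L)
    (ht : ∀ p ∈ B, t p ∈ ({(p.1, p.2.1.1), (p.1.shift p.2.1.1, p.2.1.2),
        (p.1.shift p.2.1.2, p.2.1.1), (p.1, p.2.1.2)} : Finset (Edge d L)))
    (rank : Plaquette d L → ℕ)
    (hrank : ∀ p ∈ B, ∀ p' ∈ B, p ≠ p' → t p ∈ ({(p'.1, p'.2.1.1), (p'.1.shift p'.2.1.1, p'.2.1.2),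
        (p'.1.shift p'.2.1.2, p'.2.1.1), (p'.1, p'.2.1.2)} : Finset (Edge d L)) → rank p < rank p') :
    (m / M) ^ (Finset.univ \ B).card ≤ (m / M) ^ ((d - 1) * (d - 2) / 2 * L ^ d + (d - 1)) := by
  have h := (isLeast_card_compl_ranked (d := d) hL).2 ⟨B, t, rank, ht, hrank, rfl⟩
  exact pow_le_pow_of_le_one (div_nonneg hm0.le (hm0.le.trans hmM))
    (div_le_one_of_le₀ hmM (hm0.le.trans hmM)) h

/-- **`d = 3`: the Morse sampler is accepted with probability `≥ (m/M)^{L³ + 2}`** from every state (the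
layers of GEN-24 gave `(m/M)^{L³ + 2L²}`); by `ranked_doeblin_floor_le_pow_kmin` no ranked structure of
`(ℤ/L)³` certifies more. [ours] -/
theorem morse_imhAcceptQ_ge_three (hL : 2 ≤ L) {w : G → ℝ} (hw : Continuous w) {m M : ℝ} (hm0 : 0 < m)
    (hm : ∀ g, m ≤ w g) (hM : ∀ g, w g ≤ M) (B : Finset (Plaquette 3 L)) (t : Plaquette 3 L → Edge 3 L)
    (hB : B = Finset.univ.filter (fun p : Plaquette 3 L =>
      (∀ m : Fin 3, m < p.2.1.1 → p.1 m = 0) ∧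
        (p.1 p.2.1.1 ≠ -1 ∨ ((∀ m : Fin 3, p.2.1.1 < m → m < p.2.1.2 → p.1 m = 0) ∧ p.1 p.2.1.2 ≠ -1))))
    (ht : t = fun p => if p.1 p.2.1.1 = -1 then (p.1.shift p.2.1.2, p.2.1.1) else (p.1.shift p.2.1.1, p.2.1.2))
    (l : List (Edge 3 L)) (hl : l.Nodup) (hall : ∀ e : Edge 3 L, e ∈ l) (U V : GaugeConfig 3 L G) :
    (m / M) ^ (L ^ 3 + 2) ≤
      imhAcceptQ (fun U : GaugeConfig 3 L G => ∏ p : Plaquette 3 L, w (plaquetteHolonomy U p.1 p.2.1.1 p.2.1.2))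
        (fun U : GaugeConfig 3 L G => (l.map fun b => ∏ p ∈ B.filter (fun p' => t p' = b),
            w (plaquetteHolonomy U p.1 p.2.1.1 p.2.1.2) / (∫ g, w g ∂(haarProbability G))).prod *
          coordAvg (haarProbability G) l.toFinset
            (fun V : GaugeConfig 3 L G => ∏ p ∈ B, w (plaquetteHolonomy V p.1 p.2.1.1 p.2.1.2)) U /
          (∫ V, ∏ p ∈ B, w (plaquetteHolonomy V p.1 p.2.1.1 p.2.1.2)
            ∂(Measure.pi fun _ : Edge 3 L => haarProbability G))) U V := by
  have h := morse_imhAcceptQ_ge (d := 3) (G := G) hL hw hm0 hm hM B t hB ht l hl hall U V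
  have e : (3 - 1) * (3 - 2) / 2 * L ^ 3 + (3 - 1) = L ^ 3 + 2 := by norm_num
  rw [e] at h
  exact h

/-- **`d = 4`: the Morse sampler is accepted with probability `≥ (m/M)^{3L⁴ + 3}`** from every state (the
layers gave `(m/M)^{3L⁴ + 3L³}`); no ranked structure of `(ℤ/L)⁴` certifies more. [ours] -/
theorem morse_imhAcceptQ_ge_four (hL : 2 ≤ L) {w : G → ℝ} (hw : Continuous w) {m M : ℝ} (hm0 : 0 < m)
    (hm : ∀ g, m ≤ w g) (hM : ∀ g, w g ≤ M) (B : Finset (Plaquette 4 L)) (t : Plaquette 4 L → Edge 4 L)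
    (hB : B = Finset.univ.filter (fun p : Plaquette 4 L =>
      (∀ m : Fin 4, m < p.2.1.1 → p.1 m = 0) ∧
        (p.1 p.2.1.1 ≠ -1 ∨ ((∀ m : Fin 4, p.2.1.1 < m → m < p.2.1.2 → p.1 m = 0) ∧ p.1 p.2.1.2 ≠ -1))))
    (ht : t = fun p => if p.1 p.2.1.1 = -1 then (p.1.shift p.2.1.2, p.2.1.1) else (p.1.shift p.2.1.1, p.2.1.2))
    (l : List (Edge 4 L)) (hl : l.Nodup) (hall : ∀ e : Edge 4 L, e ∈ l) (U V : GaugeConfig 4 L G) :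
    (m / M) ^ (3 * L ^ 4 + 3) ≤
      imhAcceptQ (fun U : GaugeConfig 4 L G => ∏ p : Plaquette 4 L, w (plaquetteHolonomy U p.1 p.2.1.1 p.2.1.2))
        (fun U : GaugeConfig 4 L G => (l.map fun b => ∏ p ∈ B.filter (fun p' => t p' = b),
            w (plaquetteHolonomy U p.1 p.2.1.1 p.2.1.2) / (∫ g, w g ∂(haarProbability G))).prod *
          coordAvg (haarProbability G) l.toFinset
            (fun V : GaugeConfig 4 L G => ∏ p ∈ B, w (plaquetteHolonomy V p.1 p.2.1.1 p.2.1.2)) U /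
          (∫ V, ∏ p ∈ B, w (plaquetteHolonomy V p.1 p.2.1.1 p.2.1.2)
            ∂(Measure.pi fun _ : Edge 4 L => haarProbability G))) U V := by
  have h := morse_imhAcceptQ_ge (d := 4) (G := G) hL hw hm0 hm hM B t hB ht l hl hall U V
  have e : (4 - 1) * (4 - 2) / 2 * L ^ 4 + (4 - 1) = 3 * L ^ 4 + 3 := by norm_num
  rw [e] at h
  exact h

end Summit.Ventures.LatticeQCDFlow.Theory2.Autoregressive

end
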